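import Mathlib
import HarnessLib
import Summits.NavierStokesRegularity.NavierStokesRegularity.Theorems.LocalSineTubeDoorProfileAlignedWindowRigidityAncient

/-!
# Item `PoloidalWindowRigidity` (stmt-NavierStokesRegularity-19708), LINE 20 «hot_forest» (ns-idea-8) — F2 `stub_hotSeparatrix` BY SIGNATURE (the separatrix law)

Cell ns-regularity-ideate, seat ns-k2-port-2 g4 (hand per KEY-NS #198; `--supports stmt-NavierStokesRegularity-19708 --as helper`).  The statement is
`HotSeparatrix` of `Cruxes/PoloidalWindowRigidity/Lines/hot_forest.lean` (tree sha16 f98b48b1294b4768, :500–505) VERBATIM, with the line-file abbreviations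
`Pinned C v` and `hotSet v = {y | y₂ = 0 ∧ v₂(−1,y) = v₂(−1,0)}` δ-unfolded (as R15 `…LeafUniformVortexLine.vortexLineGlobal` did), so that
`stub_hotSeparatrix : HotSeparatrix := hotSeparatrix` closes the stub by `exact`.

CLAIM.  A complete integral curve `γ` of `ω(−1,·)` one of whose ends has a CLUSTER POINT `q` in the hot set lies entirely in the hot set.
PROOF.  `y ↦ y₂` and `y ↦ v₂(−1,y)` are first integrals of `γ′ = ω(−1,γ)`: `d/dτ (γ τ)₂ = ω₂(γ τ) = 0` (poloidality, from the pinned package) and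
`d/dτ v₂(−1,γ τ) = Dv(−1,·)(γ τ)[ω(γ τ)]₂ = 0` (the frozen law); so both are constant along `γ` (`is_const_of_deriv_eq_zero`).  The set
`{y | y₂ = (γ 0)₂ ∧ v₂(−1,y) = v₂(−1,γ 0)}` is closed (the slice is continuous — indeed analytic, `analyticOnNhd_slice`) and contains the range of `γ`; a cluster
point of `γ` along `atTop`/`atBot` outside it would make `γ` visit its open complement frequently — impossible; hence `q` lies in it, and `q` hot gives
`(γ 0)₂ = 0`, `v₂(−1,γ 0) = N`, i.e. every `γ τ` is hot.

WHAT THIS IS NOT: not a claim about Navier–Stokes regularity; one S-sized stub of LINE 20 (W4 ⟨19708⟩ / N0 ⟨20428⟩ by name); 19708/20428/27893 OPEN.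
-/

noncomputable section

-- the summit and its single sub-problem share the name (CONVENTIONS §1), as in every Theorems file
set_option linter.dupNamespace false

namespace Summit.NavierStokesRegularity.NavierStokesRegularity.Theorems.PoloidalWindowDoorPoloidalWindowRigidityHotForestSeparatrix

open Set Function Filter Topology
open scoped InnerProductSpace RealInnerProductSpace Laplacian
open Literature.Analysis Literature.Analysis.FluidPDE Literature.Analysis.UnboundedOperators
open Summit.NavierStokesRegularity.NavierStokesRegularity.Theorems.LocalSineTubeDoorProfileAlignedWindowRigidityAncient

/-- A function on `ℝ` that is constant and has a cluster value: if `f ∘ u ≡ c` and `x` is a cluster point of `u` along `F`, then every closed set containing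
all `u a` contains `x`. -/
theorem mem_of_mapClusterPt {X : Type*} [TopologicalSpace X] {u : ℝ → X} {F : Filter ℝ} {x : X} (h : MapClusterPt x F u) {S : Set X}
    (hS : IsClosed S) (hu : ∀ a, u a ∈ S) : x ∈ S := by
  by_contra hx
  have hopen : Sᶜ ∈ 𝓝 x := hS.isOpen_compl.mem_nhds hx
  have hfreq := (mapClusterPt_iff_frequently.mp h) Sᶜ hopen
  obtain ⟨a, ha⟩ := hfreq.exists
  exact ha (hu a)

/-- **F2 — THE SEPARATRIX LAW (`HotSeparatrix` of LINE 20 «hot_forest», VERBATIM).**  For a pinned profile obeying the frozen law, a complete integral curve of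
`ω(−1,·)` with a cluster point in the hot set `{y₂ = 0, v₂(−1,y) = v₂(−1,0)}` at `+∞` or `−∞` runs entirely inside the hot set. -/
theorem hotSeparatrix :
    ∀ (C : ℝ) (v : ℝ → EuclideanSpace ℝ (Fin 3) → EuclideanSpace ℝ (Fin 3)),
      (Literature.Analysis.FluidPDE.HasTypeITimeDecay C v ∧
        ContinuousOn (Function.uncurry v) (Set.Iio (0 : ℝ) ×ˢ Set.univ) ∧
        (∀ s t : ℝ, s < t → t < 0 → ∀ x, v t x =
          Literature.Analysis.UnboundedOperators.heatExtension (v s) (t - s) x -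
            Literature.Analysis.FluidPDE.oseenDuhamel 1 s v v t x) ∧
        (∀ t < 0, Literature.Analysis.FluidPDE.VectorCalculus.IsDivFree (v t)) ∧
        (∀ s < 0, ∀ y, ⟪Literature.Analysis.FluidPDE.curl (v s) y, EuclideanSpace.single 2 1⟫_ℝ = 0) ∧
        v (-1) 0 2 ≠ 0 ∧ (∀ t < 0, ∀ x, Real.sqrt (-t) * |v t x 2| ≤ |v (-1) 0 2|) ∧
        (∀ h : EuclideanSpace ℝ (Fin 3), fderiv ℝ (v (-1)) 0 h 2 = 0) ∧
        (deriv (fun s => v s 0 2) (-1) = v (-1) 0 2 / 2 ∧ v (-1) 0 2 * (Δ (fun y => v (-1) y 2)) 0 ≤ 0)) →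
      (∀ s < 0, ∀ y, ⟪fderiv ℝ (v s) y (Literature.Analysis.FluidPDE.curl (v s) y), EuclideanSpace.single 2 1⟫_ℝ = 0) →
      ∀ γ : ℝ → EuclideanSpace ℝ (Fin 3), (∀ τ : ℝ, HasDerivAt γ (Literature.Analysis.FluidPDE.curl (v (-1)) (γ τ)) τ) →
        ∀ q ∈ {y : EuclideanSpace ℝ (Fin 3) | y 2 = 0 ∧ v (-1) y 2 = v (-1) 0 2},
          (MapClusterPt q Filter.atTop γ ∨ MapClusterPt q Filter.atBot γ) →
            ∀ τ : ℝ, γ τ ∈ {y : EuclideanSpace ℝ (Fin 3) | y 2 = 0 ∧ v (-1) y 2 = v (-1) 0 2} := by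
  intro C v hP hfrozen γ hγ q hq hcl τ
  obtain ⟨hrate, hcont, hmild, -, hpol, -, -, -, -⟩ := hP
  -- the slice `w = v₂(−1,·)` is analytic, hence `C¹`
  have hsl : AnalyticOnNhd ℝ (v (-1)) univ := analyticOnNhd_slice hcont (bdd_of_hasTypeITimeDecay hrate) hmild (by norm_num)
  have hw : AnalyticOnNhd ℝ (fun y => v (-1) y 2) univ := fun y _ =>
    ((EuclideanSpace.proj (𝕜 := ℝ) (2 : Fin 3)).analyticAt _).comp (hsl y (mem_univ _))
  have hwd : Differentiable ℝ (fun y => v (-1) y 2) := (hw.contDiff (n := 1)).differentiable (by simp)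
  have hvd : Differentiable ℝ (v (-1)) := (hsl.contDiff (n := 1)).differentiable (by simp)
  have hwc : Continuous (fun y => v (-1) y 2) := hwd.continuous
  -- first integral 1: the height `(γ τ)₂`
  have hh : ∀ σ, HasDerivAt (fun σ => γ σ 2) 0 σ := by
    intro σ
    have h1 : HasDerivAt (fun σ => γ σ 2) (curl (v (-1)) (γ σ) 2) σ :=
      (EuclideanSpace.proj (𝕜 := ℝ) (2 : Fin 3)).hasFDerivAt.comp_hasDerivAt σ (hγ σ)
    have h2 : curl (v (-1)) (γ σ) 2 = 0 := by
      have h := hpol (-1) (by norm_num) (γ σ)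
      rwa [EuclideanSpace.inner_single_right, one_mul, conj_trivial] at h
    rwa [h2] at h1
  -- first integral 2: the vertical velocity `v₂(−1, γ τ)`
  have hW : ∀ σ, HasDerivAt (fun σ => v (-1) (γ σ) 2) 0 σ := by
    intro σ
    have h1 : HasDerivAt (fun σ => v (-1) (γ σ) 2) (fderiv ℝ (fun y => v (-1) y 2) (γ σ) (curl (v (-1)) (γ σ))) σ :=
      (hwd (γ σ)).hasFDerivAt.comp_hasDerivAt σ (hγ σ)
    have hc : fderiv ℝ (fun y => v (-1) y 2) (γ σ) (curl (v (-1)) (γ σ)) = fderiv ℝ (v (-1)) (γ σ) (curl (v (-1)) (γ σ)) 2 := by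
      have e := ((EuclideanSpace.proj (𝕜 := ℝ) (2 : Fin 3)).hasFDerivAt.comp (γ σ) (hvd (γ σ)).hasFDerivAt).fderiv
      rw [show (fun y => v (-1) y 2) = (EuclideanSpace.proj (𝕜 := ℝ) (2 : Fin 3)) ∘ v (-1) from rfl, e]
      rfl
    have h2 : fderiv ℝ (v (-1)) (γ σ) (curl (v (-1)) (γ σ)) 2 = 0 := by
      have h := hfrozen (-1) (by norm_num) (γ σ)
      rwa [EuclideanSpace.inner_single_right, one_mul, conj_trivial] at h
    rwa [hc, h2] at h1
  -- both are constant along `γ`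
  have hh_const : ∀ σ, γ σ 2 = γ 0 2 := fun σ =>
    is_const_of_deriv_eq_zero (fun σ => (hh σ).differentiableAt) (fun σ => (hh σ).deriv) σ 0
  have hW_const : ∀ σ, v (-1) (γ σ) 2 = v (-1) (γ 0) 2 := fun σ =>
    is_const_of_deriv_eq_zero (fun σ => (hW σ).differentiableAt) (fun σ => (hW σ).deriv) σ 0
  -- the cluster point `q` lies in the closed set `{y₂ = (γ 0)₂, v₂(−1,y) = v₂(−1,γ 0)}`
  set S : Set (EuclideanSpace ℝ (Fin 3)) := {y | y 2 = γ 0 2 ∧ v (-1) y 2 = v (-1) (γ 0) 2} with hS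
  have hSc : IsClosed S := by
    have h1 : IsClosed {y : EuclideanSpace ℝ (Fin 3) | y 2 = γ 0 2} := isClosed_eq (EuclideanSpace.proj (𝕜 := ℝ) (2 : Fin 3)).continuous continuous_const
    have h2 : IsClosed {y : EuclideanSpace ℝ (Fin 3) | v (-1) y 2 = v (-1) (γ 0) 2} := isClosed_eq hwc continuous_const
    exact h1.inter h2
  have hγS : ∀ σ, γ σ ∈ S := fun σ => ⟨hh_const σ, hW_const σ⟩
  have hqS : q ∈ S := by
    rcases hcl with h | h
    · exact mem_of_mapClusterPt h hSc hγS
    · exact mem_of_mapClusterPt h hSc hγS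
  obtain ⟨hq0, hqN⟩ := hq
  obtain ⟨hq1, hq2⟩ := hqS
  exact ⟨by rw [hh_const τ, ← hq1, hq0], by rw [hW_const τ, ← hq2, hqN]⟩

end Summit.NavierStokesRegularity.NavierStokesRegularity.Theorems.PoloidalWindowDoorPoloidalWindowRigidityHotForestSeparatrix
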